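import Summits.Ventures.DiscreteObjects.MOLS.CyclicQuasigroupMOLS

/-!
# MOLS(10), family C5: the census statements, typed (cell pub-namedobj, target M)
Framing: lottery ticket; floor = certified bounds/negative ranges.

The census of family C5 (NAMEDOBJ-TABLE §M, bound-reached line (1), signed two-engine 2026-08-20 g19: designs `dlx2`
240/240 parts = 0 and verify-ref's own DLX 16/16 = 0) established by exhaustive search that NO quasigroup of order 10
satisfies the pentagonal identity `I5 : (y(xy))((xy)(y(xy))) = x`; its idempotent slice (= no `(10,5,1)`-perfect Mendelsohn
design, in print: Bennett–Zhang / Abel–Bennett–Zhang 2000) is certified control (2). Until now the table carried "census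
statement NOT typed in Lean (enumeration certificate only)". This file TYPES the two statements as named `Prop`s — they
are NOT proved here (no kernel certificate exists for a `~2.5·10⁹`-node search) — and proves the typed consequence that
matters for the target: `NoI5QuasigroupOrderTen` implies that no three MOLS(10) `L₀, L₁, L₂` have an orthogonal array
invariant under the cyclic shift of its five coordinates (`no_shiftInvariant_of_noI5`, via `identityI5_of_shiftInvariant`,
p206399). Together with `oa_aut_trivial_or_five_cycle` (p206399) and McKay–Meynert–Myrvold 2007 (print) this is the sentence
"any three MOLS(10) have a trivial OA-automorphism group". Nothing here is a cited fact; the two `def`s are census claims of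
this cell, to be discharged only by a kernel-checkable certificate (none planned).
-/

namespace Summit.Ventures.DiscreteObjects.MOLS

/-- **Census statement C5 (typed, not proved):** no binary operation on `Fin 10` that is a Latin square satisfies the
identity `I5`. Certified by two independent exhaustive enumerations (designs dlx2 240/240, verify-ref DLX 16/16; signed g19);
no kernel certificate. -/
def NoI5QuasigroupOrderTen : Prop :=
  ∀ mul : Fin 10 → Fin 10 → Fin 10, IsLatin mul → ¬ IdentityI5 mul

/-- **Census control C5−2 (typed, not proved):** no IDEMPOTENT Latin square of order 10 satisfies `I5`
(equivalently: no `(10,5,1)`-perfect Mendelsohn design; in print). Certified E1 (kissat + DRAT) and E3 (30/30 cubes + DRAT),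
signed g11; no kernel certificate. -/
def NoIdempotentI5QuasigroupOrderTen : Prop :=
  ∀ mul : Fin 10 → Fin 10 → Fin 10, IsLatin mul → (∀ x, mul x x = x) → ¬ IdentityI5 mul

/-- The full census statement contains its idempotent slice. -/
theorem noIdempotentI5_of_noI5 (h : NoI5QuasigroupOrderTen) : NoIdempotentI5QuasigroupOrderTen :=
  fun mul hl _ => h mul hl

/-- **Typed consequence for the target.** If no quasigroup of order 10 satisfies `I5`, then no three squares
`L₀, L₁, L₂` of order 10 with `L₀` Latin form an orthogonal array invariant under the cyclic shift of its five coordinates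
(`ShiftInvariant`, FAMILY-C5 §1(e)); in particular no three MOLS(10) admit the coordinate 5-cycle as an OA-automorphism in the
normal form of p206399. -/
theorem no_shiftInvariant_of_noI5 (h : NoI5QuasigroupOrderTen) (L₀ L₁ L₂ : Fin 10 → Fin 10 → Fin 10) (hL : IsLatin L₀) :
    ¬ ShiftInvariant L₀ L₁ L₂ :=
  fun hs => h L₀ hL (identityI5_of_shiftInvariant hs).1

/-- Conversely, a counterexample to the census statement would BE three MOLS(10) (the HIT route, p204049): an `I5` Latin
square `mul` yields the mutually orthogonal Latin squares `sq1 mul, sq2 mul, sq3 mul`. -/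
theorem three_MOLS_of_I5_counterexample (mul : Fin 10 → Fin 10 → Fin 10) (hL : IsLatin mul) (h5 : IdentityI5 mul) :
    IsLatin (sq1 mul) ∧ IsLatin (sq2 mul) ∧ IsLatin (sq3 mul) ∧
    Orthogonal (sq1 mul) (sq2 mul) ∧ Orthogonal (sq1 mul) (sq3 mul) ∧ Orthogonal (sq2 mul) (sq3 mul) :=
  three_MOLS_of_identityI5 (fun x y y' hxy => hL.1 x y y' hxy) h5

end Summit.Ventures.DiscreteObjects.MOLS
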